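import Mathlib.Algebra.BigOperators.Group.Finset.Basic
import Mathlib.Algebra.Module.Basic
import Mathlib.Data.Fintype.Basic
import Mathlib.Logic.Relation
import Mathlib.Algebra.BigOperators.Ring.Finset
import Mathlib.Tactic
import HarnessLib

/-!
# Crux `ThetaLayerLambdaCongruenceAtTwo` (stmt-BirchSwinnertonDyer-20688, route ResidualThetaTransportAtTwo), line
# `birth`, stub (C3k) — ITEM B1 core: the INTEGRALITY (torsion) LEMMA for Manin-symbol systems — a system killing the
# `S`- and `τ`-fixed points pairs to zero with every integer vector that is a relation after multiplication by `m ≥ 1`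
# (lead prover bsd-wall-rtt-p3 g3; `--supports stmt-BirchSwinnertonDyer-20688 --as helper`; closes nothing)

HONEST FRAMING. A self-contained COMBINATORIAL theorem about a finite set with two permutations `S` (`S² = 1`) and `τ`
(`τ³ = 1`) — no modular symbols, curves or forms appear; BSD is not proved by any of this. It is the abstract form of
the «`ℓ = 2` torsion caveat» of `Cruxes/ThetaLayerLambdaCongruenceAtTwo/Lines/birth-C3k-plan.md` (addendum, B1): for
`X = Γ₀(N')\SL₂(ℤ)` with `S = (0,−1;1,0)`, `τ = (0,−1;1,−1)` acting on the right, the Manin-symbol system `M_Ψ` of an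
`𝔪`-eigen symbol function `Ψ` (landed: `…ManinSymbols`, `…ManinTrick`, `…EllipticExclusion`) satisfies exactly the
hypotheses (i)–(iv) below, and the conclusion says that `M_Ψ` kills every integer vector `c` some multiple `m·c` of which
is an (integral) Manin relation — i.e. `M_Ψ` factors through the TORSION-FREE quotient of the integral Manin-symbol
module `ℤ[X]/(2-term, 3-term)` by its `S`/`τ`-fixed classes (`= H₁(X₀(N'), cusps; ℤ)`), although `char k = 2`.

WHAT. `X` finite, `S, τ : X → X` with `S∘S = id`, `τ∘τ∘τ = id`; `M : X → R` (`R` an additive group in which `3r = 0 ⇒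
r = 0`, e.g. any `𝔽₂`-vector space) with (i) `M(Sx) = −M(x)`, (ii) `M(x) + M(τx) + M(τ²x) = 0`, (iii) `M(x) = 0` if
`Sx = x`, (iv) `M(x) = 0` if `τx = x`. The INTEGRAL RELATIONS are the vectors `A + B + C : X → ℤ` with `A∘S = A`,
`B∘τ = B`, `C` supported on the fixed points of `S` and `τ` (= `ℤ`-span of the two-term vectors `δ_x + δ_{Sx}`, the
three-term vectors `δ_x + δ_{τx} + δ_{τ²x}`, and the fixed-point vectors). THEOREM `sum_smul_eq_zero_of_mul_eq_relation`:
if `m·c = A + B + C` with `m ≥ 1` then `Σ_x c(x)·M(x) = 0`.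
Proof (no graph theory): along the «good» `S`-edges `{x, Sx}` (no fixed point involved) `B` is constant modulo `m`
(`B(x) − B(Sx) = m(c(x) − c(Sx))`), hence constant mod `m` on the classes of the equivalence relation generated by
`x ~ τx` and good `x ~ Sx`; subtracting the class representative's value and dividing by `m` gives a `τ`-invariant
integer `B''` with `m(c − B'') = A + C + (class constant)`, so `c − B''` takes EQUAL values at the two ends of every good
edge; now `Σ B''·M = 0` by (ii)/(iv) (reindex by `τ`, `3Σ = 0`) and `Σ (c − B'')·M = 0` by the involution `S`
(`Finset.sum_involution`: good edges cancel by (i), the other points carry `M = 0` by (iii)/(iv)/(i)).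
NOT here: the instantiation `X = Γ₀(N')\SL₂(ℤ)` (tree: `ModularForms.Gamma0Coset`, `cosetPerm`) and the comparison
with `periodHomology` over `ℚ` (tree: `relModule_le_ker_msymbolMap`, `six_mul_finrank_span_periodHomology_le`, genus fact).

References: [Manin1972] Thm. 1.9; Wiese, Computational arithmetic of modular forms (in [InamBuyukasik2019]) Prop. 5.1,
Thm. 5.7 (the presentation over any ring), Thm. 5.9 (why `2`-torsion matters); [CremonaAlgorithms1997] §2.2.
-/

-- justification: the `Summit.BirchSwinnertonDyer.BirchSwinnertonDyer.…` path repeats a component (route-file convention)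
set_option linter.dupNamespace false

namespace Summit.BirchSwinnertonDyer.BirchSwinnertonDyer.Theorems.ThetaLayerLambdaCongruenceAtTwo

open Finset

section Torsion

variable {X : Type*} [Fintype X] [DecidableEq X] {R : Type*} [AddCommGroup R]

omit [Fintype X] [DecidableEq X] in
/-- Along an `S`-edge `{x, Sx}` touching no fixed point, a decomposition `m·c = A + B + C` (`A` `S`-invariant, `C`
supported on fixed points) forces `B(x) ≡ B(Sx) (mod m)`. [folklore] -/
theorem int_dvd_sub_of_good_edge (S τ : X → X) (hS : ∀ x, S (S x) = x)
    (c A B C : X → ℤ) (m : ℤ) (hA : ∀ x, A (S x) = A x)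
    (hC : ∀ x, C x ≠ 0 → S x = x ∨ τ x = x) (hrel : ∀ x, m * c x = A x + B x + C x)
    {x : X} (h1 : S x ≠ x) (h2 : τ x ≠ x) (h3 : τ (S x) ≠ S x) :
    m ∣ B x - B (S x) := by
  have hCx : C x = 0 := by
    by_contra h
    rcases hC x h with h' | h'
    · exact h1 h'
    · exact h2 h'
  have hCSx : C (S x) = 0 := by
    by_contra h
    rcases hC (S x) h with h' | h'
    · exact h1 (by rw [hS] at h'; exact h'.symm)
    · exact h3 h'
  have e1 := hrel x
  have e2 := hrel (S x)
  rw [hA] at e2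
  exact ⟨c x - c (S x), by linear_combination -e1 + e2 - hCx + hCSx⟩

/-- **The integrality (torsion) lemma for Manin-symbol systems.** See the module docstring. For `X = Γ₀(N')\SL₂(ℤ)` it
says: a `k`-valued Manin-symbol system satisfying the two- and three-term relations and VANISHING on the `S`- and
`τ`-fixed cosets kills every integer vector a multiple of which is an integral relation — the torsion of
`ℤ[X]/(relations)` is carried by the fixed cosets (Manin 1972 Thm. 1.9 / Wiese Thm. 5.7 read integrally).
[cite: Manin1972, Thm. 1.9] -/
theorem sum_smul_eq_zero_of_mul_eq_relation (S τ : X → X) (hS : ∀ x, S (S x) = x) (hτ : ∀ x, τ (τ (τ x)) = x)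
    (M : X → R) (hM₁ : ∀ x, M (S x) = -M x) (hM₂ : ∀ x, M x + M (τ x) + M (τ (τ x)) = 0)
    (hM₃ : ∀ x, S x = x → M x = 0) (hM₄ : ∀ x, τ x = x → M x = 0)
    (h3 : ∀ r : R, r + r + r = 0 → r = 0)
    (c A B C : X → ℤ) (m : ℤ) (hm : m ≠ 0)
    (hA : ∀ x, A (S x) = A x) (hB : ∀ x, B (τ x) = B x) (hC : ∀ x, C x ≠ 0 → S x = x ∨ τ x = x)
    (hrel : ∀ x, m * c x = A x + B x + C x) :
    ∑ x, c x • M x = 0 := by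
  -- the equivalence relation generated by `x ~ τx` and the good `S`-edges `x ~ Sx`
  let good : X → Prop := fun x ↦ S x ≠ x ∧ τ x ≠ x ∧ τ (S x) ≠ S x
  let Rel : X → X → Prop := fun x y ↦ y = τ x ∨ (good x ∧ y = S x)
  let s : Setoid X := Relation.EqvGen.setoid Rel
  -- `B` is constant modulo `m` on the classes
  have hBmod : ∀ x y, Relation.EqvGen Rel x y → m ∣ B x - B y := by
    intro x y h
    induction h with
    | rel a b hab =>
      rcases hab with rfl | ⟨⟨g1, g2, g3⟩, rfl⟩
      · exact ⟨0, by rw [hB, sub_self, mul_zero]⟩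
      · exact int_dvd_sub_of_good_edge S τ hS c A B C m hA hC hrel g1 g2 g3
    | refl a => exact ⟨0, by rw [sub_self, mul_zero]⟩
    | symm a b _ ih => rw [← neg_sub]; exact (dvd_neg).mpr ih
    | trans a b d _ _ ih1 ih2 =>
      have : B a - B d = (B a - B b) + (B b - B d) := by ring
      rw [this]; exact dvd_add ih1 ih2
  -- class representatives
  let rep : X → X := fun x ↦ (Quotient.mk s x).out
  have hrep : ∀ x, Relation.EqvGen Rel x (rep x) := fun x ↦
    Quotient.exact (s := s) (by rw [Quotient.out_eq])
  have hrep_τ : ∀ x, rep (τ x) = rep x := by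
    intro x
    have : (Quotient.mk s (τ x)) = Quotient.mk s x :=
      (Quotient.sound (s := s) (Relation.EqvGen.rel x (τ x) (Or.inl rfl))).symm
    simp only [rep, this]
  have hrep_S : ∀ x, good x → rep (S x) = rep x := by
    intro x hx
    have : (Quotient.mk s (S x)) = Quotient.mk s x :=
      (Quotient.sound (s := s) (Relation.EqvGen.rel x (S x) (Or.inr ⟨hx, rfl⟩))).symm
    simp only [rep, this]
  -- `B'' = (B − B∘rep)/m`, an integer-valued `τ`-invariant function
  have hdvd : ∀ x, m ∣ B x - B (rep x) := fun x ↦ hBmod x (rep x) (hrep x)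
  let B'' : X → ℤ := fun x ↦ (B x - B (rep x)) / m
  have hB''m : ∀ x, m * B'' x = B x - B (rep x) := fun x ↦ Int.mul_ediv_cancel' (hdvd x)
  have hB''τ : ∀ x, B'' (τ x) = B'' x := by
    intro x; simp only [B'', hB, hrep_τ]
  -- `m (c − B'') = A + C + B∘rep`
  have hkey : ∀ x, m * (c x - B'' x) = A x + C x + B (rep x) := by
    intro x; rw [mul_sub, hB''m x, hrel x]; ring
  -- equal values at the two ends of a good edge
  have hgoodeq : ∀ x, good x → c (S x) - B'' (S x) = c x - B'' x := by
    intro x hx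
    obtain ⟨g1, g2, g3⟩ := hx
    have hCx : C x = 0 := by
      by_contra h
      rcases hC x h with h' | h'
      · exact g1 h'
      · exact g2 h'
    have hCSx : C (S x) = 0 := by
      by_contra h
      rcases hC (S x) h with h' | h'
      · exact g1 (by rw [hS] at h'; exact h'.symm)
      · exact g3 h'
    have e1 := hkey x
    have e2 := hkey (S x)
    rw [hA, hCSx, hrep_S x ⟨g1, g2, g3⟩] at e2
    rw [hCx] at e1
    have : m * (c (S x) - B'' (S x)) = m * (c x - B'' x) := by rw [e1, e2]
    exact mul_left_cancel₀ hm this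
  -- (1) `Σ B''·M = 0` by `τ`-reindexing and (ii)
  have hτbij : Function.Bijective τ := by
    refine (Function.bijective_iff_has_inverse).mpr ⟨fun x ↦ τ (τ x), fun x ↦ ?_, fun x ↦ ?_⟩
    · show τ (τ (τ x)) = x; exact hτ x
    · show τ (τ (τ x)) = x; exact hτ x
  have hsumB : ∑ x, B'' x • M x = 0 := by
    set T := ∑ x, B'' x • M x with hT
    have h1 : ∑ x, B'' x • M (τ x) = T := by
      rw [hT]
      rw [← Function.Bijective.sum_comp hτbij (fun x ↦ B'' x • M x)]
      exact Finset.sum_congr rfl fun x _ ↦ by rw [hB''τ]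
    have h2 : ∑ x, B'' x • M (τ (τ x)) = T := by
      rw [← h1]
      rw [← Function.Bijective.sum_comp hτbij (fun x ↦ B'' x • M (τ x))]
      exact Finset.sum_congr rfl fun x _ ↦ by rw [hB''τ]
    apply h3
    calc T + T + T = ∑ x, B'' x • M x + ∑ x, B'' x • M (τ x) + ∑ x, B'' x • M (τ (τ x)) := by
          rw [h1, h2]
      _ = ∑ x, B'' x • (M x + M (τ x) + M (τ (τ x))) := by
          rw [← Finset.sum_add_distrib, ← Finset.sum_add_distrib]
          exact Finset.sum_congr rfl fun x _ ↦ by rw [smul_add, smul_add]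
      _ = 0 := Finset.sum_eq_zero fun x _ ↦ by rw [hM₂ x, smul_zero]
  -- (2) `Σ (c − B'')·M = 0` by the involution `S`
  have hsumS : ∑ x, (c x - B'' x) • M x = 0 := by
    refine Finset.sum_involution (fun x _ ↦ S x) (fun x _ ↦ ?_) (fun x _ hne ↦ ?_) (fun x _ ↦ Finset.mem_univ _)
      (fun x _ ↦ hS x)
    · -- `f x + f (S x) = 0`
      by_cases hfix : S x = x
      · rw [hfix, hM₃ x hfix, smul_zero, add_zero]
      · by_cases hτx : τ x = x
        · rw [hM₁, hM₄ x hτx, neg_zero, smul_zero, smul_zero, add_zero]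
        · by_cases hτS : τ (S x) = S x
          · have hMS : M (S x) = 0 := hM₄ (S x) hτS
            have hMx : M x = 0 := by
              have := hM₁ (S x); rw [hS, hMS, neg_zero] at this; exact this
            rw [hMS, hMx, smul_zero, smul_zero, add_zero]
          · rw [hgoodeq x ⟨hfix, hτx, hτS⟩, hM₁, smul_neg, add_neg_cancel]
    · -- `f x ≠ 0 → S x ≠ x`
      intro hfix
      apply hne
      rw [hM₃ x hfix, smul_zero]
  -- assemble
  have e : ∑ x, c x • M x = ∑ x, (c x - B'' x) • M x + ∑ x, B'' x • M x := by
    rw [← Finset.sum_add_distrib]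
    exact Finset.sum_congr rfl fun x _ ↦ by rw [← add_smul, sub_add_cancel]
  rw [e, hsumS, hsumB, add_zero]

end Torsion

end Summit.BirchSwinnertonDyer.BirchSwinnertonDyer.Theorems.ThetaLayerLambdaCongruenceAtTwo
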